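import Literature.Geometry.Symplectic.SteinDomain
import Literature.Topology.FourManifolds.KnotFraming
import Literature.Topology.PlaneTopology.WindingNumber
import Mathlib.Geometry.Manifold.SmoothEmbedding
import Mathlib.Analysis.Calculus.LocalExtr.Basic
import HarnessLib

/-!
# The contact structure on the boundary of a Stein domain: complex tangencies, Legendrian
# knots, the canonical (Thurston–Bennequin) framing and the twisting number of a framing

Topic `Literature/Geometry/Symplectic`; vocabulary for the layer below Theorem 3 of
Akbulut–Matveyev (1998) (`AkbulutMatveyev.lean`, fact `Literature.Geometry.Symplectic.akbulut_matveyev`, XL):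
Eliashberg's Legendrian-surgery theorem (AM Thm. 2 = Gompf 1998, Thm. 1.3), Legendrian
`C⁰`-approximation and the *defect* of a 2-handle (AM §3) all speak about Legendrian knots in
the boundary `∂W` of a compact Stein domain `W` (`Literature.Symplectic.SteinStructure W`,
`SteinDomain.lean`) and about framings of such knots *relative to the canonical framing*.
None of this exists in Mathlib or in the tree (`LegendrianKirbyDiagram.lean` is the purely
combinatorial front-diagram layer).  Everything here is a definition or is **proved**.

Sources.  Akbulut–Matveyev (1998), §1: *"Boundary `∂X` of PC manifold `X` inherits a contact
structure `ξ`, which, in this case, is a distribution of maximal complex subspaces in `TX`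
tangent to `∂X`"*; *"`α = ∂F ⊂ ∂X` is a Legendrian knot with respect to induced contact
structure … `tb(α)` is Thurston–Bennequin framing defined by the vector field along `α`
transversal to `α` and tangent to contact distribution"*; §3: *"the defect `D(h²)` of a
2-handle `h²` attached to a Legendrian knot `K` on the boundary of PC manifold with framing `f`
is a number `max{f + 1 - tb(K), 0}`"*.  Gompf (1998), §1 (p. 4 of arXiv:math/9803019): *"A link
… in a contact 3-manifold is called Legendrian if its tangent vectors all lie in `ξ`. … A
Legendrian link comes equipped with a canonical framing of its normal bundle (up to fiber
homotopy and orientation reversal), which is induced by any vector field transverse to `ξ`, or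
equivalently, by a vector field in `ξ|L` transverse to `L` … we can find a `C⁰`-small isotopy …
that adds any number of left (negative) twists to the canonical framing"*; Thm. 1.3 (c): *"The
framing for attaching each `hᵢ` is obtained from the canonical framing on `Kᵢ` by adding a
single left (negative) twist"* (p. 6; and *"`iτ` goes to the canonical framing"*).

## Contents (all for a compact `C^∞` 4-manifold with boundary `W`, model `𝓡∂ 4`, tangent
spaces `T_xW = E4 := EuclideanSpace ℝ (Fin 4)` read in the preferred chart at `x`, as in
`SteinDomain.lean`)

* `boundaryTangentSpace : Submodule ℝ E4` — `T_x∂W = {v | v 0 = 0}` at a boundary point `x`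
  (the preferred chart at `x` presents `W` near `x` as `{y | 0 ≤ y 0}` near a point of
  `{y 0 = 0}`; the convention "outward `⇔ v 0 < 0`" of `IsLiouvilleDomain.outward`);
* `contactPlane J x = T_x∂W ⊓ (J x)⁻¹ T_x∂W` — the complex tangencies `ξ_x` (AM §1);
* `SteinStructure.contactForm S x = -dφ_x ∘ J_x` (`α = -d^ℂφ`, Cieliebak–Eliashberg 2012, Ch. 2;
  we only use it through its kernel and its sign) and
  `SteinStructure.kahlerForm S x u v = -dd^ℂφ_x(u, v)` (the form whose positivity on `(v, Jv)`
  is `SteinStructure.convex`; AM §1 "`ω = (i/2)∂∂̄ψ`");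
* `IsLegendrianKnot J K` — a smooth embedding `K : 𝕊¹ → W` into the boundary whose tangent
  vectors lie in `ξ` (Gompf §1; AM §1);
* `knotVelocity K t` — the velocity `ċ(t) ∈ T_{c t}W` of the unit-period parametrisation
  `c = K ∘ circlePt` (`TorusCoordinates.lean`); `canonicalFraming J K` — the vector field `J ċ`
  along `K` (AM's "vector field along `α` transversal to `α` and tangent to contact
  distribution", Gompf's `iτ`); `IsKnotFraming K ν` — a framing of `K` in `∂W`: a continuous
  vector field `ν` along `K`, tangent to `∂W`, nowhere tangent to `K`;
* `SteinStructure.twisting S K ν : ℤ` — the **twisting number of the framing `ν` relative to the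
  canonical framing** of the Legendrian knot `K` ("`f - tb(K)`"): the winding number
  (`Literature.Topology.PlaneTopology.wind`, `WindingNumber.lean`) of the loop
  `t ↦ (ω(ċ, ν), α(ν)) ∈ ℝ² = ℂ`, i.e. the rotation number of `ν` in the normal bundle of `K`
  in `∂W` with respect to the frame `(J ċ, R)`, `J ċ ∈ ξ` the canonical framing vector
  (Gompf: "`iτ` goes to the canonical framing") and `R` tangent to `∂W`, positively transverse
  to `ξ` (`α(R) > 0`): modulo `ċ`, `ν ≡ a Jċ + b R` with `(ω(ċ, ν), α(ν)) = (a ω(ċ, Jċ), b α(R))`,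
  `ω(ċ, Jċ) > 0`.  Sign: `∂W` carries the boundary orientation (outward normal first) of the
  complex orientation of `W`, for which `(out, ċ, Jċ, R)` is positive, so positive twisting =
  right-handed twists; checked on `∂B⁴ ⊂ ℂ²` with the Legendrian unknot
  `t ↦ (e^{it}, e^{-it})/√2`, whose canonical framing is the Clifford-torus framing `-1 = tb`;
* `SteinStructure.defect S K ν : ℕ = max {twisting + 1, 0}` — AM's defect of a 2-handle attached
  along `K` with framing `ν` (§3).

## Proved API

`J`-invariance of `ξ` (`SteinStructure.J_mem_contactPlane_iff`); **`dφ` vanishes exactly on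
`T∂W` at boundary points** (`SteinStructure.mfderiv_φ_apply_eq_zero`,
`SteinStructure.mfderiv_φ_apply_eq_zero_iff`: `φ` attains its maximum along `∂W`, Fermat's
theorem within the half-space `IsLocalMaxOn.fderivWithin_eq_zero`, and `dφ ≠ 0` there), whence
`ξ_x = ker dφ_x ⊓ ker α_x` (`SteinStructure.contactPlane_eq`, the description
"`ξ = ker (d^ℂφ|∂W)`"), `α` vanishes on `ξ`; `ω(v, Jv) > 0`; the velocity of a Legendrian knot
lies in `ξ` (`IsLegendrianKnot.knotVelocity_mem`, chain rule), only depends on the point of the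
circle (`knotVelocity_add_int`) and never vanishes (`knotVelocity_ne_zero`: a smooth embedding
is an immersion, `KnotFraming.lean`); the canonical framing vector `J ċ` lies in `ξ` and is
nowhere tangent to `K` (`canonicalFraming_not_mem_span`: `J` has no real eigenvalue), and its
twisting loop is the positive real number `ω(ċ, Jċ)`
(`IsLegendrianKnot.twistingLoop_canonicalFraming`: the canonical framing sits at angle `0`).
Not proved here: continuity and non-vanishing of the twisting loop of a general framing of a
Legendrian knot (bundle-level continuity of the pairings; outside these hypotheses `twisting`
is the junk value of `Literature.Topology.PlaneTopology.wind`).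

## What is NOT here

Attaching a 4-dimensional 2-handle *along a prescribed framed knot* (needed to state AM Thm. 2
(2) / Gompf Thm. 1.3 (b)–(c) and the defect-reduction lemma of AM §3 as named facts) is a
separate definition item of topic `Topology/FourManifolds` (cf. the scope note of
`LegendrianKirbyDiagram.lean`); `Handles.lean` is Morse-theoretic and records no attaching maps.

## References

* S. Akbulut, R. Matveyev, *A convex decomposition theorem for 4-manifolds*, IMRN 1998, no. 7,
  371–381 (arXiv:math/0010166), §1, §3. [AkbulutMatveyev1998]
* R. E. Gompf, *Handlebody construction of Stein surfaces*, Ann. of Math. 148 (1998), 619–693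
  (arXiv:math/9803019), §1 and Thm. 1.3. [Gompf1998]
* K. Cieliebak, Ya. Eliashberg, *From Stein to Weinstein and back*, AMS Colloquium Publ. 59
  (2012), Ch. 2 (J-convex functions and hypersurfaces, `d^ℂφ`, the Levi form).
  [CieliebakEliashberg2012]
-/

noncomputable section

open scoped Manifold ContDiff Topology
open Set Function

namespace Literature.Geometry.Symplectic

/-- The model vector space `ℝ⁴` of the tangent spaces. [folklore] -/
local notation "E4" => EuclideanSpace ℝ (Fin 4)

/-- Local notation: `𝕊 n` is the unit sphere in `EuclideanSpace ℝ (Fin (n + 1))`. -/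
local notation "𝕊 " n:arg => (Metric.sphere (0 : EuclideanSpace ℝ (Fin (n + 1))) 1)

variable {W : Type*}

/-! ### The tangent space of the boundary and the complex tangencies -/

/-- **The tangent space `T_x∂W` of the boundary at a boundary point `x`**, inside
`T_xW = E4`: the hyperplane `{v | v 0 = 0}`.  The tangent space at `x` is read in the
preferred chart at `x`, which identifies `W` near a boundary point `x` with the half-space
`{y | 0 ≤ y 0}` near a point of its boundary hyperplane `{y | y 0 = 0}`
(`ModelWithCorners.isBoundaryPoint_iff`, `frontier_range_modelWithCornersEuclideanHalfSpace`);
this is the convention "outward `⇔ v 0 < 0`" of `IsLiouvilleDomain.outward`.  (At interior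
points the definition is not meaningful and not used.) [folklore] -/
def boundaryTangentSpace : Submodule ℝ E4 :=
  LinearMap.ker (EuclideanSpace.proj (0 : Fin 4) : E4 →L[ℝ] ℝ).toLinearMap

/-- `v ∈ T∂W ⇔ v 0 = 0`. [folklore] -/
@[simp] theorem mem_boundaryTangentSpace_iff (v : E4) : v ∈ boundaryTangentSpace ↔ v 0 = 0 :=
  Iff.rfl

/-- **The complex tangencies** `ξ_x = T_x∂W ∩ J_x⁻¹(T_x∂W)` of the boundary at `x` for a field
of endomorphisms `J` (for `J_x² = -1` this is `T_x∂W ∩ J_x T_x∂W`, the maximal `J`-complex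
subspace of `T_x∂W`): *"Boundary `∂X` of PC manifold `X` inherits a contact structure `ξ`,
which, in this case, is a distribution of maximal complex subspaces in `TX` tangent to `∂X`"*.
[cite: AkbulutMatveyev1998, §1] -/
def contactPlane (J : (x : W) → (E4 →L[ℝ] E4)) (x : W) : Submodule ℝ E4 :=
  boundaryTangentSpace ⊓ boundaryTangentSpace.comap (J x).toLinearMap

/-- `v ∈ ξ_x ⇔ v 0 = 0 ∧ (J v) 0 = 0`. [folklore] -/
@[simp] theorem mem_contactPlane_iff (J : (x : W) → (E4 →L[ℝ] E4)) (x : W) (v : E4) :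
    v ∈ contactPlane J x ↔ v 0 = 0 ∧ J x v 0 = 0 :=
  Iff.rfl

/-- `ξ_x ⊆ T_x∂W`. [folklore] -/
theorem contactPlane_le_boundaryTangentSpace (J : (x : W) → (E4 →L[ℝ] E4)) (x : W) :
    contactPlane J x ≤ boundaryTangentSpace :=
  inf_le_left

variable [TopologicalSpace W] [ChartedSpace (EuclideanHalfSpace 4) W] [IsManifold (𝓡∂ 4) ∞ W]
  [CompactSpace W]

namespace SteinStructure

/-- `ξ` is `J`-invariant: `J v ∈ ξ_x ⇔ v ∈ ξ_x` (from `J² = -1`). [folklore] -/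
theorem J_mem_contactPlane_iff (S : SteinStructure W) (x : W) (v : E4) :
    S.J x v ∈ contactPlane S.J x ↔ v ∈ contactPlane S.J x := by
  simp only [mem_contactPlane_iff, S.J_sq, PiLp.neg_apply, neg_eq_zero]
  exact and_comm

/-! ### The contact form `α = -d^ℂφ` and the Kähler form `ω = -dd^ℂφ` -/

/-- The differential `dφ_x : T_xW → ℝ` of the defining function. [folklore] -/
abbrev dφ (S : SteinStructure W) (x : W) : E4 →L[ℝ] ℝ :=
  mfderiv (𝓡∂ 4) 𝓘(ℝ, ℝ) S.φ x

/-- **The contact form** `α_x = -dφ_x ∘ J_x` (`α = -d^ℂφ`; its restriction to `T∂W` is a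
contact form for `ξ = T∂W ∩ ker α`, `contactPlane_eq`). [Cieliebak–Eliashberg 2012, Ch. 2;
Gompf 1998, §1 (`ξ` as the kernel of a 1-form)] [folklore] -/
def contactForm (S : SteinStructure W) (x : W) : E4 →L[ℝ] ℝ :=
  -((S.dφ x).comp (S.J x))

/-- `α_x(v) = -dφ_x(J_x v)`. [folklore] -/
@[simp] theorem contactForm_apply (S : SteinStructure W) (x : W) (v : E4) :
    S.contactForm x v = -(S.dφ x (S.J x v)) :=
  rfl

/-- **The Kähler form** `ω_x(u, v) = -dd^ℂφ_x(u, v)` of the Stein structure (AM §1: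
*"such manifold admits a symplectic structure `ω = (i/2)∂∂̄ψ`"*); `ω(v, Jv) > 0` for `v ≠ 0`
is `J`-convexity (`SteinStructure.convex`). [cite: AkbulutMatveyev1998, §1] -/
def kahlerForm (S : SteinStructure W) (x : W) (u v : E4) : ℝ :=
  -(Kaehler.mextDeriv (dComplex S.J S.φ) x ![u, v])

/-- `ω(v, Jv) > 0` for `v ≠ 0` (`J`-convexity of `φ`). [cite: Gompf1998, §1] -/
theorem kahlerForm_self_J_pos (S : SteinStructure W) (x : W) {v : E4} (hv : v ≠ 0) :
    0 < S.kahlerForm x v (S.J x v) :=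
  S.convex x v hv

/-! ### `dφ` vanishes exactly on `T∂W` along the boundary -/

/-- `φ ≤ max φ = φ(x)` for a boundary point `x`. [folklore] -/
theorem φ_le_of_isBoundaryPoint (S : SteinStructure W) {x : W} (hx : (𝓡∂ 4).IsBoundaryPoint x)
    (z : W) : S.φ z ≤ S.φ x := by
  rw [(S.boundary_eq x).1 hx]
  exact le_csSup (isCompact_range S.φ_smooth.continuous).bddAbove (mem_range_self z)

/-- **`dφ_x` vanishes on `T_x∂W` at a boundary point `x`**: `φ` attains its maximum along `∂W`,
so by Fermat's theorem within the half-space (`IsLocalMaxOn.fderivWithin_eq_zero`, both `v` and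
`-v` being tangent directions of the half-space when `v 0 = 0`) its differential kills the
boundary hyperplane. [folklore] -/
theorem mfderiv_φ_apply_eq_zero (S : SteinStructure W) {x : W} (hx : (𝓡∂ 4).IsBoundaryPoint x)
    {v : E4} (hv : v 0 = 0) : S.dφ x v = 0 := by
  have hd : MDifferentiableAt (𝓡∂ 4) 𝓘(ℝ, ℝ) S.φ x := S.φ_smooth.mdifferentiableAt (by simp)
  rw [dφ, mfderiv, if_pos hd]
  set g : E4 → ℝ := writtenInExtChartAt (𝓡∂ 4) 𝓘(ℝ, ℝ) x S.φ with hg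
  set y₀ : E4 := extChartAt (𝓡∂ 4) x x with hy₀
  have hy₀0 : y₀ 0 = 0 := by
    have h := (ModelWithCorners.isBoundaryPoint_iff.1 hx)
    rw [frontier_range_modelWithCornersEuclideanHalfSpace] at h
    exact (h : 0 = y₀ 0).symm
  -- `g` has a local maximum on the half-space at `y₀`
  have hmax : IsLocalMaxOn g (range (𝓡∂ 4)) y₀ := by
    filter_upwards [extChartAt_target_mem_nhdsWithin (I := 𝓡∂ 4) x] with y hy
    have h1 : g y = S.φ ((extChartAt (𝓡∂ 4) x).symm y) := by
      simp only [hg, writtenInExtChartAt, Function.comp_apply, extChartAt_model_space_eq_id,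
        PartialEquiv.refl_coe, id_eq]
    have h2 : g y₀ = S.φ x := by
      simp only [hg, hy₀, writtenInExtChartAt, Function.comp_apply, extChartAt_model_space_eq_id,
        PartialEquiv.refl_coe, id_eq, extChartAt_to_inv]
    rw [h1, h2]
    exact S.φ_le_of_isBoundaryPoint hx _
  -- both `v` and `-v` are tangent directions of the half-space at `y₀`
  have hconv : Convex ℝ (range (𝓡∂ 4)) := by
    rw [range_modelWithCornersEuclideanHalfSpace]
    exact (convex_Ici (0 : ℝ)).linear_preimage
      ((EuclideanSpace.proj (0 : Fin 4) : E4 →L[ℝ] ℝ).toLinearMap)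
  have hmem : ∀ w : E4, w 0 = 0 → w ∈ posTangentConeAt (range (𝓡∂ 4)) y₀ := by
    intro w hw
    apply mem_posTangentConeAt_of_segment_subset
    apply hconv.segment_subset (mem_range_self _)
    rw [range_modelWithCornersEuclideanHalfSpace]
    show (0 : ℝ) ≤ (y₀ + w) 0
    rw [PiLp.add_apply, hy₀0, hw, add_zero]
  exact hmax.fderivWithin_eq_zero (hmem v hv) (hmem (-v) (by rw [PiLp.neg_apply, hv, neg_zero]))

/-- **`ker dφ_x = T_x∂W` at a boundary point**: `dφ_x v = 0 ⇔ v 0 = 0` (the boundary is a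
regular level set of `φ`, `SteinStructure.regular`). [folklore] -/
theorem mfderiv_φ_apply_eq_zero_iff (S : SteinStructure W) {x : W}
    (hx : (𝓡∂ 4).IsBoundaryPoint x) (v : E4) : S.dφ x v = 0 ↔ v 0 = 0 := by
  refine ⟨fun hv => ?_, S.mfderiv_φ_apply_eq_zero hx⟩
  by_contra h0
  apply S.regular x hx
  -- `dφ_x` vanishes on the hyperplane and on the transverse vector `v`, hence everywhere
  have key : ∀ w : E4, S.dφ x w = 0 := fun w => by
    set c : ℝ := w 0 / v 0
    have hw : (w - c • v) 0 = 0 := by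
      rw [PiLp.sub_apply, PiLp.smul_apply, smul_eq_mul, div_mul_cancel₀ _ h0, sub_self]
    have := S.mfderiv_φ_apply_eq_zero hx hw
    rwa [map_sub, map_smul, hv, smul_zero, sub_zero] at this
  exact ContinuousLinearMap.ext key

/-- The contact form vanishes on the complex tangencies (at a boundary point). [folklore] -/
theorem contactForm_apply_eq_zero (S : SteinStructure W) {x : W} (hx : (𝓡∂ 4).IsBoundaryPoint x)
    {v : E4} (hv : v ∈ contactPlane S.J x) : S.contactForm x v = 0 := by
  have h2 : S.J x v 0 = 0 := hv.2
  rw [contactForm_apply, S.mfderiv_φ_apply_eq_zero hx h2, neg_zero]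

/-- `dφ` vanishes on the complex tangencies (at a boundary point). [folklore] -/
theorem dφ_apply_eq_zero (S : SteinStructure W) {x : W} (hx : (𝓡∂ 4).IsBoundaryPoint x)
    {v : E4} (hv : v ∈ contactPlane S.J x) : S.dφ x v = 0 :=
  S.mfderiv_φ_apply_eq_zero hx hv.1

/-- **`ξ = ker dφ ∩ ker d^ℂφ` along the boundary**: at a boundary point `x`,
`ξ_x = ker dφ_x ⊓ ker α_x` (Cieliebak–Eliashberg 2012, Ch. 2: the complex tangencies of the
regular level set of a `J`-convex function). [folklore] -/
theorem contactPlane_eq (S : SteinStructure W) {x : W} (hx : (𝓡∂ 4).IsBoundaryPoint x) :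
    contactPlane S.J x = LinearMap.ker (S.dφ x).toLinearMap ⊓
      LinearMap.ker (S.contactForm x).toLinearMap := by
  ext v
  simp only [mem_contactPlane_iff, Submodule.mem_inf, LinearMap.mem_ker,
    ContinuousLinearMap.coe_coe, contactForm_apply, neg_eq_zero,
    S.mfderiv_φ_apply_eq_zero_iff hx]

/-- At a boundary point, a vector tangent to `∂W` on which `α` vanishes lies in `ξ`. [folklore] -/
theorem mem_contactPlane_of_contactForm_eq_zero (S : SteinStructure W) {x : W}
    (hx : (𝓡∂ 4).IsBoundaryPoint x) {v : E4} (hv : v 0 = 0) (hα : S.contactForm x v = 0) :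
    v ∈ contactPlane S.J x := by
  rw [S.contactPlane_eq hx]
  exact ⟨(S.mfderiv_φ_apply_eq_zero_iff hx v).2 hv, hα⟩

end SteinStructure

/-! ### Legendrian knots in the boundary -/

omit [IsManifold (𝓡∂ 4) ∞ W] [CompactSpace W] in
/-- **A Legendrian knot in the boundary of `W`** (for the field of endomorphisms `J`): a
smooth embedding `K : S¹ → W` of the circle taking values in `∂W` all of whose tangent vectors
lie in the complex tangencies `ξ` — *"a link in a contact 3-manifold is called Legendrian if
its tangent vectors all lie in `ξ`"*. [cite: Gompf1998, §1] -/
structure IsLegendrianKnot (J : (x : W) → (E4 →L[ℝ] E4)) (K : 𝕊 1 → W) : Prop where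
  /-- `K` is a `C^∞` embedding -/
  isSmoothEmbedding : Manifold.IsSmoothEmbedding (𝓡 1) (𝓡∂ 4) ∞ K
  /-- `K` lies in the boundary -/
  isBoundaryPoint : ∀ u, (𝓡∂ 4).IsBoundaryPoint (K u)
  /-- the tangent vectors of `K` lie in `ξ` -/
  mfderiv_mem : ∀ u w, mfderiv (𝓡 1) (𝓡∂ 4) K u w ∈ contactPlane J (K u)

omit [IsManifold (𝓡∂ 4) ∞ W] [CompactSpace W] in
/-- **The velocity `ċ(t) ∈ T_{c(t)}W` of the unit-period parametrisation** `c = K ∘ circlePt`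
(`circlePt t = (cos 2πt, sin 2πt)`, `TorusCoordinates.lean`) of a loop `K : S¹ → W`; unlike a
derivative along a chart vector of `S¹` it does not depend on the charts of the circle.
[folklore] -/
def knotVelocity (K : 𝕊 1 → W) (t : ℝ) : E4 :=
  mfderiv 𝓘(ℝ, ℝ) (𝓡∂ 4) (K ∘ Literature.Topology.FourManifolds.circlePt) t (1 : ℝ)

omit [IsManifold (𝓡∂ 4) ∞ W] [CompactSpace W] in
/-- Chain rule: `ċ(t) = dK (d circlePt/dt)`. [folklore] -/
theorem knotVelocity_eq {K : 𝕊 1 → W} {t : ℝ} (hK : MDifferentiableAt (𝓡 1) (𝓡∂ 4) K (Literature.Topology.FourManifolds.circlePt t)) :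
    knotVelocity K t =
      mfderiv (𝓡 1) (𝓡∂ 4) K (Literature.Topology.FourManifolds.circlePt t) (mfderiv 𝓘(ℝ, ℝ) (𝓡 1) Literature.Topology.FourManifolds.circlePt t (1 : ℝ)) := by
  rw [knotVelocity, mfderiv_comp t hK (Literature.Topology.FourManifolds.contMDiff_circlePt.mdifferentiableAt (by simp))]
  rfl

omit [IsManifold (𝓡∂ 4) ∞ W] [CompactSpace W] in
/-- The velocity only depends on the point of the circle: `ċ(t + m) = ċ(t)` for `m ∈ ℤ`
(all derivative types are read in the model space `E4`: unifying `T_{c(t)}W` with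
`T_{c(t+m)}W` through the base points is prohibitively slow for the elaborator, through the
model space it is immediate). [folklore] -/
theorem knotVelocity_add_int {K : 𝕊 1 → W} (hK : MDifferentiable (𝓡 1) (𝓡∂ 4) K) (t : ℝ)
    (m : ℤ) : knotVelocity K (t + m) = knotVelocity K t := by
  have hc : MDifferentiable 𝓘(ℝ, ℝ) (𝓡∂ 4) (K ∘ Literature.Topology.FourManifolds.circlePt) := fun s =>
    (hK _).comp s (Literature.Topology.FourManifolds.contMDiff_circlePt.mdifferentiableAt (by simp))
  have h1 : HasMFDerivAt 𝓘(ℝ, ℝ) 𝓘(ℝ, ℝ) (fun s : ℝ => s + m) t (ContinuousLinearMap.id ℝ ℝ) :=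
    ((hasFDerivAt_id t).add_const (m : ℝ)).hasMFDerivAt
  have heq : (K ∘ Literature.Topology.FourManifolds.circlePt) =ᶠ[𝓝 t] ((K ∘ Literature.Topology.FourManifolds.circlePt) ∘ fun s : ℝ => s + m) :=
    Filter.Eventually.of_forall fun s => by
      show K (Literature.Topology.FourManifolds.circlePt s) = K (Literature.Topology.FourManifolds.circlePt (s + m))
      rw [Literature.Topology.FourManifolds.circlePt_add_int]
  set L : ℝ →L[ℝ] E4 :=
    (mfderiv 𝓘(ℝ, ℝ) (𝓡∂ 4) (K ∘ Literature.Topology.FourManifolds.circlePt) (t + m)).comp (ContinuousLinearMap.id ℝ ℝ) with hL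
  have h2 : HasMFDerivAt 𝓘(ℝ, ℝ) (𝓡∂ 4) (K ∘ Literature.Topology.FourManifolds.circlePt) t L :=
    ((hc (t + m)).hasMFDerivAt.comp t h1).congr_of_eventuallyEq heq
  have h3 : (mfderiv 𝓘(ℝ, ℝ) (𝓡∂ 4) (K ∘ Literature.Topology.FourManifolds.circlePt) t : ℝ →L[ℝ] E4) = L := h2.mfderiv
  show (mfderiv 𝓘(ℝ, ℝ) (𝓡∂ 4) (K ∘ Literature.Topology.FourManifolds.circlePt) (t + m) (1 : ℝ) : E4) =
    (mfderiv 𝓘(ℝ, ℝ) (𝓡∂ 4) (K ∘ Literature.Topology.FourManifolds.circlePt) t : ℝ →L[ℝ] E4) (1 : ℝ)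
  rw [h3, hL]
  rfl

omit [IsManifold (𝓡∂ 4) ∞ W] [CompactSpace W] in
/-- `ċ(t + 1) = ċ(t)`. [folklore] -/
theorem knotVelocity_add_one {K : 𝕊 1 → W} (hK : MDifferentiable (𝓡 1) (𝓡∂ 4) K) (t : ℝ) :
    knotVelocity K (t + 1) = knotVelocity K t := by
  have h := knotVelocity_add_int hK t 1
  rwa [Int.cast_one] at h

omit [IsManifold (𝓡∂ 4) ∞ W] [CompactSpace W] in
/-- The velocity at two parameters of the same point of the circle agree. [folklore] -/
theorem knotVelocity_eq_of_circlePt_eq {K : 𝕊 1 → W} (hK : MDifferentiable (𝓡 1) (𝓡∂ 4) K)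
    {s t : ℝ} (h : Literature.Topology.FourManifolds.circlePt s = Literature.Topology.FourManifolds.circlePt t) : knotVelocity K s = knotVelocity K t := by
  obtain ⟨m, rfl⟩ := Literature.Topology.FourManifolds.circlePt_eq_circlePt_iff.1 h
  exact knotVelocity_add_int hK t m

omit [CompactSpace W] in
/-- **A smoothly embedded circle is a regular curve**: `ċ(t) ≠ 0` (the differentials of the
covering `circlePt` and of the immersion `K` are injective; `KnotFraming.lean`). [folklore] -/
theorem knotVelocity_ne_zero {K : 𝕊 1 → W} (hK : Manifold.IsSmoothEmbedding (𝓡 1) (𝓡∂ 4) ∞ K)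
    (t : ℝ) : knotVelocity K t ≠ 0 := by
  haveI := Fact.mk (@finrank_euclideanSpace_fin ℝ _ (3 + 1))
  obtain ⟨F, _, _, hF⟩ := hK.isImmersion
  have h2 : Injective (mfderiv (𝓡 1) (𝓡∂ 4) K (Literature.Topology.FourManifolds.circlePt t)) :=
    Literature.Topology.FourManifolds.Manifold.IsImmersionAtOfComplement.mfderiv_injective (hF (Literature.Topology.FourManifolds.circlePt t)) (by simp)
  have h1 := Literature.Topology.FourManifolds.mfderiv_circlePt_injective t
  rw [knotVelocity_eq (hK.contMDiff.mdifferentiableAt (by simp))]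
  intro h0
  have h3 : mfderiv 𝓘(ℝ, ℝ) (𝓡 1) Literature.Topology.FourManifolds.circlePt t (1 : ℝ) = 0 := h2 (h0.trans (map_zero _).symm)
  exact (one_ne_zero (α := ℝ)) (h1 (h3.trans (map_zero _).symm))

omit [IsManifold (𝓡∂ 4) ∞ W] [CompactSpace W] in
/-- The velocity of a Legendrian knot lies in the complex tangencies. [cite: Gompf1998, §1] -/
theorem IsLegendrianKnot.knotVelocity_mem {J : (x : W) → (E4 →L[ℝ] E4)} {K : 𝕊 1 → W}
    (hK : IsLegendrianKnot J K) (t : ℝ) : knotVelocity K t ∈ contactPlane J (K (Literature.Topology.FourManifolds.circlePt t)) := by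
  rw [knotVelocity_eq ((hK.isSmoothEmbedding.contMDiff.mdifferentiableAt (by simp)))]
  exact hK.mfderiv_mem _ _

/-- Along a Legendrian knot the contact form kills the velocity … [folklore] -/
theorem IsLegendrianKnot.contactForm_knotVelocity {S : SteinStructure W} {K : 𝕊 1 → W}
    (hK : IsLegendrianKnot S.J K) (t : ℝ) :
    S.contactForm (K (Literature.Topology.FourManifolds.circlePt t)) (knotVelocity K t) = 0 :=
  S.contactForm_apply_eq_zero (hK.isBoundaryPoint _) (hK.knotVelocity_mem t)

/-- … and the canonical framing vector `J ċ`, which again lies in `ξ`.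
[cite: Gompf1998, §1 and p. 6 ("`iτ` goes to the canonical framing")] -/
theorem IsLegendrianKnot.J_knotVelocity_mem {S : SteinStructure W} {K : 𝕊 1 → W}
    (hK : IsLegendrianKnot S.J K) (t : ℝ) :
    S.J (K (Literature.Topology.FourManifolds.circlePt t)) (knotVelocity K t) ∈ contactPlane S.J (K (Literature.Topology.FourManifolds.circlePt t)) :=
  (S.J_mem_contactPlane_iff _ _).2 (hK.knotVelocity_mem t)

/-! ### The canonical framing vector field `J ċ` -/

omit [IsManifold (𝓡∂ 4) ∞ W] [CompactSpace W] in
/-- **The canonical framing vector field of a knot** `K` for `J`: `u ↦ J (ċ)` at `u`, the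
velocity read at any parameter over `u` (`angA u`, `TorusCoordinates.lean`; independent of the
choice by `knotVelocity_eq_of_circlePt_eq`).  For a Legendrian `K` this is *"the vector field
along `α` transversal to `α` and tangent to contact distribution"* defining the
Thurston–Bennequin framing (AM §1), Gompf's `iτ` ("`iτ` goes to the canonical framing", p. 6).
[cite: AkbulutMatveyev1998, §1] -/
def canonicalFraming (J : (x : W) → (E4 →L[ℝ] E4)) (K : 𝕊 1 → W) (u : 𝕊 1) : E4 :=
  J (K u) (knotVelocity K (Literature.Topology.FourManifolds.angA u))

omit [IsManifold (𝓡∂ 4) ∞ W] [CompactSpace W] in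
/-- Over the parameter `t` the canonical framing vector is `J ċ(t)`. [folklore] -/
theorem canonicalFraming_circlePt (J : (x : W) → (E4 →L[ℝ] E4)) {K : 𝕊 1 → W}
    (hK : MDifferentiable (𝓡 1) (𝓡∂ 4) K) (t : ℝ) :
    canonicalFraming J K (Literature.Topology.FourManifolds.circlePt t) = J (K (Literature.Topology.FourManifolds.circlePt t)) (knotVelocity K t) := by
  unfold canonicalFraming
  rw [knotVelocity_eq_of_circlePt_eq hK (Literature.Topology.FourManifolds.circlePt_angA (Literature.Topology.FourManifolds.circlePt t))]

omit [IsManifold (𝓡∂ 4) ∞ W] [CompactSpace W] in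
/-- The canonical framing of a Legendrian knot is tangent to the contact planes, in particular to
`∂W`. [cite: Gompf1998, §1] -/
theorem IsLegendrianKnot.canonicalFraming_mem {J : (x : W) → (E4 →L[ℝ] E4)} {K : 𝕊 1 → W}
    (hK : IsLegendrianKnot J K) (hJ : ∀ x v, J x (J x v) = -v) (u : 𝕊 1) :
    canonicalFraming J K u ∈ contactPlane J (K u) := by
  have ht := hK.knotVelocity_mem (Literature.Topology.FourManifolds.angA u)
  simp only [mem_contactPlane_iff] at ht ⊢
  unfold canonicalFraming
  refine ⟨?_, ?_⟩
  · have := ht.2; rwa [Literature.Topology.FourManifolds.circlePt_angA] at this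
  · rw [hJ, PiLp.neg_apply, ht.1, neg_zero]

omit [CompactSpace W] in
/-- The canonical framing vector is nowhere tangent to the knot: `J ċ ∉ ℝ ċ`, since `J` has no
real eigenvalue (`J² = -1`) and `ċ ≠ 0`. [folklore] -/
theorem canonicalFraming_not_mem_span {J : (x : W) → (E4 →L[ℝ] E4)} {K : 𝕊 1 → W}
    (hK : Manifold.IsSmoothEmbedding (𝓡 1) (𝓡∂ 4) ∞ K) (hJ : ∀ x v, J x (J x v) = -v) (t : ℝ) :
    canonicalFraming J K (Literature.Topology.FourManifolds.circlePt t) ∉ (ℝ ∙ knotVelocity K t : Submodule ℝ E4) := by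
  rw [canonicalFraming_circlePt J (fun u => hK.contMDiff.mdifferentiableAt (by simp)) t,
    Submodule.mem_span_singleton]
  rintro ⟨c, hc⟩
  have hv := knotVelocity_ne_zero hK t
  set v : E4 := knotVelocity K t
  have h2 : J (K (Literature.Topology.FourManifolds.circlePt t)) (J (K (Literature.Topology.FourManifolds.circlePt t)) v) = (c * c) • v := by
    rw [← hc, map_smul, ← hc, smul_smul]
  rw [hJ] at h2
  have h3 : (c * c + 1) • v = 0 := by rw [add_smul, one_smul, ← h2, neg_add_cancel]
  rw [smul_eq_zero] at h3
  rcases h3 with h3 | h3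
  · nlinarith [mul_self_nonneg c]
  · exact hv h3

/-! ### Framings of a knot in the boundary and the twisting number -/

omit [IsManifold (𝓡∂ 4) ∞ W] [CompactSpace W] in
/-- **A framing of the knot `K` in `∂W`**: a vector field `ν` along `K` (`ν u ∈ T_{K u}W`),
continuous as a map into the tangent bundle, tangent to `∂W`, and nowhere tangent to `K`
(so that, modulo `TK`, it is a nowhere-vanishing section of the normal bundle of `K` in `∂W`,
i.e. a framing "up to fiber homotopy", Gompf 1998, §1; AM §1: "framing … induced by a
trivialization of the normal bundle"). [cite: Gompf1998, §1] -/
structure IsKnotFraming (K : 𝕊 1 → W) (ν : 𝕊 1 → E4) : Prop where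
  /-- `ν` is a continuous vector field along `K` -/
  continuous : Continuous fun u => (Bundle.TotalSpace.mk' E4 (K u) (ν u) : TangentBundle (𝓡∂ 4) W)
  /-- `ν` is tangent to the boundary -/
  mem_boundaryTangentSpace : ∀ u, ν u ∈ boundaryTangentSpace
  /-- `ν` is nowhere tangent to `K` -/
  not_mem_span : ∀ t : ℝ, ν (Literature.Topology.FourManifolds.circlePt t) ∉ (ℝ ∙ knotVelocity K t : Submodule ℝ E4)

namespace SteinStructure

/-- **The twisting loop of a framing `ν` of a knot `K`**: `t ↦ (ω(ċ(t), ν), α(ν)) ∈ ℝ² = ℂ`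
along the unit-period parametrisation.  For a Legendrian `K` these are the coordinates of `ν`
(modulo `ċ`) in the frame `(J ċ, R)` of the normal bundle of `K` in `∂W` — `J ċ ∈ ξ` the
canonical framing vector, `R ∈ T∂W` positively transverse to `ξ` — up to the positive factors
`ω(ċ, Jċ)`, `α(R)`: `ω(ċ, ċ) = 0 = α(ċ) = α(Jċ)`. [cite: Gompf1998, §1] -/
def twistingLoop (S : SteinStructure W) (K : 𝕊 1 → W)
    (ν : 𝕊 1 → E4) (t : ℝ) : ℂ :=
  ⟨S.kahlerForm (K (Literature.Topology.FourManifolds.circlePt t)) (knotVelocity K t) (ν (Literature.Topology.FourManifolds.circlePt t)),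
    S.contactForm (K (Literature.Topology.FourManifolds.circlePt t)) (ν (Literature.Topology.FourManifolds.circlePt t))⟩

/-- **The twisting number of the framing `ν` relative to the canonical framing of the
Legendrian knot `K`** — the integer "`f - tb(K)`" of Gompf (1998), §1 / Akbulut–Matveyev
(1998), §3 (for a nullhomologous `K` both the framing `f` of `ν` and the Thurston–Bennequin
invariant `tb(K)`, the integer of the canonical framing, are integers; in general only their
difference is): the winding number about `0` of the twisting loop (`Literature.Topology.PlaneTopology.wind`), i.e. the number
of right-handed twists of `ν` with respect to the canonical framing `(J ċ, R)` as one traverses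
`K` (`∂W` oriented as the boundary of the complex orientation of `W`; "adding a single left
(negative) twist to the canonical framing", Gompf Thm. 1.3 (c), is twisting number `-1`).  It
does not depend on the orientation of `K`. [cite: Gompf1998, §1 and Thm. 1.3 (c)] -/
def twisting (S : SteinStructure W) (K : 𝕊 1 → W)
    (ν : 𝕊 1 → E4) : ℤ :=
  Literature.Topology.PlaneTopology.wind (S.twistingLoop K ν)

/-- **The defect of a 2-handle attached along the Legendrian knot `K` with framing `ν`**:
*"the defect `D(h²)` of a 2-handle `h²` attached to a Legendrian knot `K` on the boundary of PC
manifold with framing `f` is a number `max{f + 1 - tb(K), 0}`"*, with `f - tb(K)` the twisting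
number of `ν`. [cite: AkbulutMatveyev1998, §3] -/
def defect (S : SteinStructure W) (K : 𝕊 1 → W)
    (ν : 𝕊 1 → E4) : ℕ :=
  (S.twisting K ν + 1).toNat

/-- Unfolding the twisting loop: real part `ω(ċ, ν)`, imaginary part `α(ν)`. [folklore] -/
@[simp] theorem twistingLoop_apply (S : SteinStructure W) (K : 𝕊 1 → W)
    (ν : 𝕊 1 → E4) (t : ℝ) :
    S.twistingLoop K ν t = ⟨S.kahlerForm (K (Literature.Topology.FourManifolds.circlePt t)) (knotVelocity K t) (ν (Literature.Topology.FourManifolds.circlePt t)),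
      S.contactForm (K (Literature.Topology.FourManifolds.circlePt t)) (ν (Literature.Topology.FourManifolds.circlePt t))⟩ :=
  rfl

/-- The twisting loop has period `1` (so that `Literature.Topology.PlaneTopology.wind` reads it as a closed loop). [folklore] -/
theorem twistingLoop_add_one (S : SteinStructure W) {K : 𝕊 1 → W}
    (hK : MDifferentiable (𝓡 1) (𝓡∂ 4) K) (ν : 𝕊 1 → E4) (t : ℝ) :
    S.twistingLoop K ν (t + 1) = S.twistingLoop K ν t := by
  simp only [twistingLoop]
  rw [knotVelocity_add_one hK t, Literature.Topology.FourManifolds.circlePt_add_one]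

/-- **The canonical framing sits at angle `0`**: along a Legendrian knot the twisting loop of
the canonical framing `J ċ` is the positive real number `ω(ċ, Jċ)` (`α(Jċ) = 0` and
`J`-convexity), so that it has twisting number `0` as soon as it is continuous.
[cite: Gompf1998, §1] -/
theorem _root_.Literature.Geometry.Symplectic.IsLegendrianKnot.twistingLoop_canonicalFraming {S : SteinStructure W}
    {K : 𝕊 1 → W} (hK : IsLegendrianKnot S.J K) (t : ℝ) :
    S.twistingLoop K (canonicalFraming S.J K) t =
        (S.kahlerForm (K (Literature.Topology.FourManifolds.circlePt t)) (knotVelocity K t)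
          (S.J (K (Literature.Topology.FourManifolds.circlePt t)) (knotVelocity K t)) : ℂ) ∧
      0 < S.kahlerForm (K (Literature.Topology.FourManifolds.circlePt t)) (knotVelocity K t)
          (S.J (K (Literature.Topology.FourManifolds.circlePt t)) (knotVelocity K t)) := by
  have hd : MDifferentiable (𝓡 1) (𝓡∂ 4) K := fun u =>
    hK.isSmoothEmbedding.contMDiff.mdifferentiableAt (by simp)
  refine ⟨?_, S.kahlerForm_self_J_pos _ (knotVelocity_ne_zero hK.isSmoothEmbedding t)⟩
  rw [twistingLoop_apply, canonicalFraming_circlePt S.J hd t]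
  apply Complex.ext
  · rfl
  · simp only [Complex.ofReal_im]
    exact S.contactForm_apply_eq_zero (hK.isBoundaryPoint _) (hK.J_knotVelocity_mem t)

/-- The defect vanishes iff the twisting number is at most `-1` (framing `≤ tb - 1`: "if
`tb(K) ≥ f + 1` then … manifold `Z ∪ h` possesses PC structure"). [cite: AkbulutMatveyev1998, §3] -/
theorem defect_eq_zero_iff (S : SteinStructure W) (K : 𝕊 1 → W)
    (ν : 𝕊 1 → E4) : S.defect K ν = 0 ↔ S.twisting K ν ≤ -1 := by
  rw [defect, Int.toNat_eq_zero]; omega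

end SteinStructure

end Literature.Geometry.Symplectic

end
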